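import Summits.CriticalPhenomena.PercolationContinuityZ3.Theorems.PercNearOneGluingNoHeavyLowerTailPairGainExchange
import Summits.CriticalPhenomena.PercolationContinuityZ3.Theorems.PercNearOneGluingNoHeavyLowerTailMergeGainTools
import HarnessLib

/-!
# `NoHeavyLowerTail` (stmt-CriticalPhenomena-4575) — pair-gain monotonicity in GRAPH form: raising the pair `pp'` to a sure bond
# helps the weaker endpoint `p` at least as much as any third vertex `z`

Support file (lemma factory `prim-lf-3` gen 7, seat g9; `--supports stmt-CriticalPhenomena-4575`).  No definitions, no named
facts, no sorries.  Memo: `run/shared/lean/prim/prim-lf-3/LF3-BETA-R.md` §12–13.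

* `real_openConn_pair_third` — pushforward of a third vertex under gluing one pair: `μ_{g[s(x,y)↦1]}(v ↔ b) =
  μ_g({v ↔ b} ∪ {v ↔ x, y ↔ b} ∪ {v ↔ y, x ↔ b})`.
* `pairGlue_gain_le` — if `μ_g(p ↔ b) ≤ μ_g(p' ↔ b)` then for every `z`:
  `μ_{g[pp'↦1]}(z ↔ b) − μ_g(z ↔ b) ≤ μ_{g[pp'↦1]}(p ↔ b) − μ_g(p ↔ b)`  (from `pairGain_le`).
This is the form used for the empty atom of the formal face (memo §13 (a): `g_{p*} − g_j ≥ 0`).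
-/

namespace Summit.CriticalPhenomena.PercolationContinuityZ3.Theorems

open MeasureTheory Set ProbabilityTheory
open Literature.Probability.LatticeModels
open Literature.Probability.Percolation

noncomputable section
open Classical

namespace UpsetExchange

variable {n : ℕ}

/-- Pushforward of `{v ↔ b}` under gluing the single pair `s(x,y)`. [folklore] -/
theorem real_openConn_pair_third (g : Sym2 (Fin n) → unitInterval) {x y : Fin n} (hxy : x ≠ y) (v b : Fin n) :
    (prodBernoulli (fun f : Sym2 (Fin n) => if f = s(x, y) then 1 else g f)).real (openConn v b) =
      (prodBernoulli g).real (openConn v b ∪ openConn v x ∩ openConn y b ∪ openConn v y ∩ openConn x b) := by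
  set e : Sym2 (Fin n) := s(x, y) with he
  set gp : Sym2 (Fin n) → unitInterval := fun f => if f = e then 1 else g f with hgp
  have hpush : (prodBernoulli gp).real (openConn v b) =
      (prodBernoulli g).real {ω | ((ω ∪ {e} : Set (Sym2 (Fin n))) : BondConfig (Fin n)) ∈ openConn v b} :=
    glueSet_pushforward g gp {e} (fun f hf => by rw [mem_singleton_iff.1 hf]; simp [hgp])
      (fun f hf => by
        have hf' : f ≠ e := fun h => hf (h ▸ mem_singleton _)
        simp [hgp, hf']) (openConn v b)
  rw [hpush]; congr 1; ext ω
  simp only [mem_setOf_eq, mem_union, mem_inter_iff]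
  constructor
  · intro h
    rcases WeakestPort.reachable_union_pair (x := x) (y := y) (h : (openGraph _).Reachable v b) with h1 | ⟨h2, h3⟩ | ⟨h2, h3⟩
    · exact Or.inl (Or.inl h1)
    · exact Or.inl (Or.inr ⟨h2, h3⟩)
    · exact Or.inr ⟨h2, h3⟩
  · rintro ((h | ⟨h2, h3⟩) | ⟨h2, h3⟩)
    · exact WeakestPort.reachable_union_pair_of hxy (Or.inl h)
    · exact WeakestPort.reachable_union_pair_of hxy (Or.inr (Or.inl ⟨h2, h3⟩))
    · exact WeakestPort.reachable_union_pair_of hxy (Or.inr (Or.inr ⟨h2, h3⟩))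

/-- **Pair-gain monotonicity.**  If `μ_g(p ↔ b) ≤ μ_g(p' ↔ b)`, then making `pp'` a sure bond increases `μ(z ↔ b)` by at most the increase
of `μ(p ↔ b)`, for every vertex `z`. [cite: KozmaNitzan2024, Lemma 3(i) (p. 6), Lemma 5 (p. 13)] -/
theorem pairGlue_gain_le (g : Sym2 (Fin n) → unitInterval) {p p' : Fin n} (hpp : p ≠ p') (z b : Fin n)
    (hyp : (prodBernoulli g).real (openConn p b) ≤ (prodBernoulli g).real (openConn p' b)) :
    (prodBernoulli (fun f : Sym2 (Fin n) => if f = s(p, p') then 1 else g f)).real (openConn z b) -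
        (prodBernoulli g).real (openConn z b) ≤
      (prodBernoulli (fun f : Sym2 (Fin n) => if f = s(p, p') then 1 else g f)).real (openConn p b) -
        (prodBernoulli g).real (openConn p b) := by
  have hmeas : ∀ X : Set (BondConfig (Fin n)), MeasurableSet X := fun _ => MeasurableSet.of_discrete
  rw [real_openConn_pair_third g hpp z b, (real_openConn_pair_eq g hpp b).1]
  -- `μ(A ∪ W) − μ(A) = μ(W \ A)` twice
  set W : Set (BondConfig (Fin n)) := openConn z p ∩ openConn p' b ∪ openConn z p' ∩ openConn p b with hW
  have hzu : openConn z b ∪ openConn z p ∩ openConn p' b ∪ openConn z p' ∩ openConn p b = openConn z b ∪ (W \ openConn z b) := by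
    rw [hW]; ext ω; simp only [mem_union, mem_inter_iff, mem_sdiff]; tauto
  have hpu : openConn p b ∪ openConn p' b = openConn p b ∪ (openConn p' b \ openConn p b) := by
    ext ω; simp only [mem_union, mem_sdiff]; tauto
  rw [hzu, hpu, measureReal_union disjoint_sdiff_right ((hmeas _).diff (hmeas _)),
    measureReal_union disjoint_sdiff_right ((hmeas _).diff (hmeas _))]
  have h1 : W \ openConn z b = (openConn z b)ᶜ ∩ (openConn z p ∩ openConn p' b ∪ openConn z p' ∩ openConn p b) := by
    rw [hW]; ext ω; simp only [mem_sdiff, mem_inter_iff, mem_compl_iff, mem_union]; tauto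
  have h2 : openConn p' b \ openConn p b = openConn p' b ∩ (openConn p b)ᶜ := by
    ext ω; simp only [mem_sdiff, mem_inter_iff, mem_compl_iff]
  rw [h1, h2]
  linarith [pairGain_le g p p' z b hyp]

end UpsetExchange

end

end Summit.CriticalPhenomena.PercolationContinuityZ3.Theorems
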